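import Summits.CriticalPhenomena.PercolationContinuityZ3.Theorems.PercNearOneGluingNoHeavyLowerTailQuantitativeHarrisExplicitStrictness
import Summits.CriticalPhenomena.PercolationContinuityZ3.Theorems.PercNearOneGluingNoHeavyLowerTailQuantitativeS5FloorCompleteFar
import HarnessLib

/-!
# An explicit, size-dependent floor for the (S5) margin from ONE isolated witness: `margin ≥ p₀^{3|E|+2} · J`

Support file (`--supports stmt-CriticalPhenomena-4575`), prover seat `prim-rate-mine-2` (lane prim-rate, constants-miner (c), BENCH row
M2-R47; `run/shared/lean/prim/prim-rate/prim-rate-mine-2/PROOFS.md` §P47).  No definitions, no named facts, no sorries; standard axioms.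

Weights `w = 0` off a finite support `E` and `p₀ ≤ w ≤ 1 − p₀` on `E` (`0 < p₀`); relays `T`, observers `o ≠ v` off `T`; `F` monotone `≥ 0`;
`r` injective on `T` and compatible with the means.  Row M2-R21/M2-R30's explicit floor has, at the relay `a`, the isolated Harris term
`∏_{f ∩ T_{<a} ≠ ∅}(1 − w_f) · Cov_{w_{T_{<a}}}(F(V 𝒞_a), 1{o ↔ {a} ∪ T_{>a} ∨ o ↔ v})`, positive iff a pair `e` missing `T_{<a}` is (separately)
influential for both factors inside the pairs of `E` missing `T_{<a}` (`CSH.floor_iso_pos_of_pivotal`).  QUANTITATIVELY: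

* `CSH.floor_iso_ge_explicit` — with such witnesses `η₁` (an `F`-jump `J`) and `η₂`, the term is **`≥ p₀^{3|E|+2} · J`**
  (`QuantHarris.cov_ge_pow_mul_jumps` at the zeroed weights — support `⊆ E`, jump of the event's indicator `= 1` — and `∏(1 − w) ≥ p₀^{|E|}`);
* `CSH.s5dMargin_nil_ge_explicit` — hence **`p₀^{3|E|+2} · J ≤ s5dMargin w T r [] o v F`** (the other summands of the floor are `≥ 0` at a
  compatible rank, `CSH.isolatedFloor_term_nonneg`; floor `≤` margin, `CSH.s5dMargin_ge_sum_rankGain_add_isolatedFloor_of_lt_one_of_compat`).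

This is the «margin lower bound versus box size» of the seat's charter in the isolated/pivotal regime (for `F = 1{b ∈ ·}`, `J = 1`): exponential
in `|E|`, which is the true order (path family, row M2-R47).  The rank-gain regime `γ·q` has no uniform floor (it scales with mean GAPS).
[cite: Harris1960, Lemma 4.1 (p. 16)] [cite: KozmaNitzan2024, Conj. 4 (p. 32)] [cite: Talagrand1996, Thm. 1.1 (p. 244)]
-/

noncomputable section

namespace Summit.CriticalPhenomena.PercolationContinuityZ3.Theorems

open MeasureTheory Set Literature.Probability.LatticeModels Literature.Probability.Percolation
open scoped Classical
open KNPreFKG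

namespace CSH

variable {n : ℕ}

/-- **Explicit isolated Harris term.**  Weights `w = 0` off the finite support `E`, `p₀ ≤ w ≤ 1 − p₀` on `E` (`0 < p₀`); `F` monotone
nonnegative; a pair `e ∈ E` missing `T_{<a}`, an `F(V 𝒞_a)`-witness `η₁` (jump `J`) and a witness `η₂` for the floor's event, both inside the
pairs of `E` missing `T_{<a}`.  Then the `a`-term `∏(1 − w)·Cov` of the floor (general decoy list) is at least `p₀^{3|E|+2}·J`.
[cite: Harris1960, Lemma 4.1 (p. 16)] [cite: Talagrand1996, Thm. 1.1 (p. 244)] -/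
theorem floor_iso_ge_explicit (w : Sym2 (Fin n) → unitInterval) (E : Finset (Sym2 (Fin n))) (p₀ : ℝ) (hp0 : 0 < p₀)
    (hE0 : ∀ f, f ∉ E → (w f : ℝ) = 0) (hE1 : ∀ f ∈ E, p₀ ≤ (w f : ℝ) ∧ (w f : ℝ) ≤ 1 - p₀) (o v : Fin n)
    (T : Finset (Fin n)) (r : Fin n → ℕ) (D : List (Fin n)) (a : Fin n)
    (F : Set (Fin n) → ℝ) (hF : ∀ S S' : Set (Fin n), S ⊆ S' → F S ≤ F S') (hF0 : ∀ S : Set (Fin n), 0 ≤ F S)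
    (e : Sym2 (Fin n)) (heE : e ∈ E) (heY : ∀ y ∈ (↑(T.filter (fun b => r b < r a)) : Set (Fin n)), y ∉ e)
    (η₁ : Set (Sym2 (Fin n))) (hη₁ : η₁ ⊆ {f | f ∈ (↑E : Set (Sym2 (Fin n))) ∧ ∀ y ∈ (↑(T.filter (fun b => r b < r a)) : Set (Fin n)), y ∉ f})
    (η₂ : Set (Sym2 (Fin n))) (hη₂ : η₂ ⊆ {f | f ∈ (↑E : Set (Sym2 (Fin n))) ∧ ∀ y ∈ (↑(T.filter (fun b => r b < r a)) : Set (Fin n)), y ∉ f})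
    (hU1 : insert e η₂ ∈ ((⋃ t ∈ (insert a (T.filter (fun b => r a < r b) ∪ D.toFinset)), openConn o t) ∪ openConn o v :
        Set (BondConfig (Fin n))))
    (hU0 : η₂ \ {e} ∉ ((⋃ t ∈ (insert a (T.filter (fun b => r a < r b) ∪ D.toFinset)), openConn o t) ∪ openConn o v :
        Set (BondConfig (Fin n)))) :
    p₀ ^ (3 * E.card + 2) *
        (F {c | c = a ∨ ∃ e' ∈ openEdgeCluster (insert e η₁) a, c ∈ e'} - F {c | c = a ∨ ∃ e' ∈ openEdgeCluster (η₁ \ {e}) a, c ∈ e'}) ≤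
      (∏ e ∈ Finset.univ.filter (fun e : Sym2 (Fin n) => ∃ y ∈ (↑(T.filter (fun b => r b < r a)) : Set (Fin n)), y ∈ e), (1 - (w e : ℝ))) *
          ((∫ η in ((⋃ t ∈ (insert a (T.filter (fun b => r a < r b) ∪ (D).toFinset)), openConn o t) ∪ openConn o v),
              F {c | c = a ∨ ∃ e ∈ openEdgeCluster η a, c ∈ e}
              ∂(prodBernoulli fun e => if (∃ y ∈ (↑(T.filter (fun b => r b < r a)) : Set (Fin n)), y ∈ e) then (0 : unitInterval) else w e)) -
            (prodBernoulli fun e => if (∃ y ∈ (↑(T.filter (fun b => r b < r a)) : Set (Fin n)), y ∈ e) then (0 : unitInterval) else w e).real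
                ((⋃ t ∈ (insert a (T.filter (fun b => r a < r b) ∪ (D).toFinset)), openConn o t) ∪ openConn o v) *
              (∫ η, F {c | c = a ∨ ∃ e ∈ openEdgeCluster η a, c ∈ e}
                ∂(prodBernoulli fun e => if (∃ y ∈ (↑(T.filter (fun b => r b < r a)) : Set (Fin n)), y ∈ e) then (0 : unitInterval) else w e))) := by
  have hmeas : ∀ S : Set (BondConfig (Fin n)), MeasurableSet S := fun _ => MeasurableSet.of_discrete
  have hp01 : p₀ ≤ 1 := by linarith [(hE1 e heE).1, (hE1 e heE).2]
  set Y : Set (Fin n) := (↑(T.filter (fun b => r b < r a)) : Set (Fin n)) with hY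
  set U : Set (BondConfig (Fin n)) :=
    (⋃ t ∈ (insert a (T.filter (fun b => r a < r b) ∪ D.toFinset)), openConn o t) ∪ openConn o v with hU
  set qY : Sym2 (Fin n) → unitInterval := fun e => if (∃ y ∈ Y, y ∈ e) then (0 : unitInterval) else w e with hqY
  set EY : Finset (Sym2 (Fin n)) := E.filter (fun f => ∀ y ∈ Y, y ∉ f) with hEY
  set f : BondConfig (Fin n) → ℝ := fun ζ => F {c | c = a ∨ ∃ e ∈ openEdgeCluster ζ a, c ∈ e} with hfdef
  have hUup : ∀ ω ω' : BondConfig (Fin n), ω ⊆ ω' → ω ∈ U → ω' ∈ U := by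
    rintro ω ω' hle (h | h)
    · obtain ⟨t, ht, h⟩ := Set.mem_iUnion₂.1 h
      exact Or.inl (Set.mem_iUnion₂.2 ⟨t, ht, SimpleGraph.Reachable.mono (BHK2006.openGraph_le hle) h⟩)
    · exact Or.inr (SimpleGraph.Reachable.mono (BHK2006.openGraph_le hle) h)
  have hfmono : Monotone f := fun _ _ h => (monotone_clusterFun a F hF) (BHK2006.openEdgeCluster_mono h a)
  have hf0 : ∀ ζ, 0 ≤ f ζ := fun _ => hF0 _
  -- the zeroed weights: support `EY ⊆ E`, same bounds
  have hq0 : ∀ g, g ∉ EY → ((qY g : unitInterval) : ℝ) = 0 := by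
    intro g hg
    simp only [hqY]
    by_cases hc : ∃ y ∈ Y, y ∈ g
    · rw [if_pos hc]; rfl
    · rw [if_neg hc]
      apply hE0 g
      intro hgE
      exact hg (Finset.mem_filter.2 ⟨hgE, fun y hy hyg => hc ⟨y, hy, hyg⟩⟩)
  have hq1 : ∀ g ∈ EY, p₀ ≤ ((qY g : unitInterval) : ℝ) ∧ ((qY g : unitInterval) : ℝ) ≤ 1 - p₀ := by
    intro g hg
    obtain ⟨hgE, hgY⟩ := Finset.mem_filter.1 hg
    have hc : ¬ ∃ y ∈ Y, y ∈ g := by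
      rintro ⟨y, hy, hyg⟩
      exact hgY y hy hyg
    simp only [hqY]
    rw [if_neg hc]
    exact hE1 g hgE
  have heEY : e ∈ EY := Finset.mem_filter.2 ⟨heE, heY⟩
  have hη₁' : η₁ ⊆ ↑EY := fun g hg => Finset.mem_coe.2 (Finset.mem_filter.2 ⟨Finset.mem_coe.1 (hη₁ hg).1, (hη₁ hg).2⟩)
  have hη₂' : η₂ ⊆ ↑EY := fun g hg => Finset.mem_coe.2 (Finset.mem_filter.2 ⟨Finset.mem_coe.1 (hη₂ hg).1, (hη₂ hg).2⟩)
  -- explicit Harris strictness at the zeroed weights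
  have hcov := QuantHarris.cov_ge_pow_mul_jumps qY EY p₀ hp0.le hq0 hq1 f (U.indicator fun _ => (1 : ℝ)) hf0
    (fun ω => Set.indicator_nonneg (fun _ _ => zero_le_one) ω) hfmono (QuantHarris.indicator_upset_monotone hUup)
    e heEY η₁ hη₁' η₂ hη₂'
  rw [Set.indicator_of_mem hU1, Set.indicator_of_notMem hU0, sub_zero, mul_one] at hcov
  have hprod : (fun ζ => f ζ * U.indicator (fun _ => (1 : ℝ)) ζ) = U.indicator f := by
    funext ζ
    by_cases hζ : ζ ∈ U
    · rw [Set.indicator_of_mem hζ, Set.indicator_of_mem hζ, mul_one]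
    · rw [Set.indicator_of_notMem hζ, Set.indicator_of_notMem hζ, mul_zero]
  rw [hprod, integral_indicator (hmeas U), integral_indicator (hmeas U)] at hcov
  simp only [integral_const, smul_eq_mul, mul_one, measureReal_restrict_apply_univ] at hcov
  -- hcov : p₀ ^ (2 * EY.card + 2) * J ≤ ∫_U f − (∫ f) * μ(U)
  have hJ0 : 0 ≤ f (insert e η₁) - f (η₁ \ {e}) := sub_nonneg.2 (hfmono (fun x hx => Set.mem_insert_of_mem e hx.1))
  have hcardEY : EY.card ≤ E.card := Finset.card_filter_le _ _
  -- the prefactor `∏ (1 − w) ≥ p₀ ^ |E|`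
  have hpref : p₀ ^ E.card ≤ ∏ g ∈ Finset.univ.filter (fun g : Sym2 (Fin n) => ∃ y ∈ Y, y ∈ g), (1 - (w g : ℝ)) := by
    have hsplit := Finset.prod_filter_mul_prod_filter_not (Finset.univ.filter (fun g : Sym2 (Fin n) => ∃ y ∈ Y, y ∈ g))
      (fun g => g ∈ E) (fun g => (1 - (w g : ℝ)))
    rw [← hsplit]
    have h1 : p₀ ^ E.card ≤ ∏ g ∈ (Finset.univ.filter (fun g : Sym2 (Fin n) => ∃ y ∈ Y, y ∈ g)).filter (fun g => g ∈ E), (1 - (w g : ℝ)) := by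
      have hsub : (Finset.univ.filter (fun g : Sym2 (Fin n) => ∃ y ∈ Y, y ∈ g)).filter (fun g => g ∈ E) ⊆ E :=
        fun g hg => (Finset.mem_filter.1 hg).2
      calc p₀ ^ E.card ≤ p₀ ^ ((Finset.univ.filter (fun g : Sym2 (Fin n) => ∃ y ∈ Y, y ∈ g)).filter (fun g => g ∈ E)).card :=
            pow_le_pow_of_le_one hp0.le hp01 (Finset.card_le_card hsub)
        _ = ∏ _g ∈ (Finset.univ.filter (fun g : Sym2 (Fin n) => ∃ y ∈ Y, y ∈ g)).filter (fun g => g ∈ E), p₀ :=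
            (Finset.prod_const p₀).symm
        _ ≤ _ := Finset.prod_le_prod (fun _ _ => hp0.le) fun g hg => by linarith [(hE1 g (Finset.mem_filter.1 hg).2).2]
    have h2 : ∏ g ∈ (Finset.univ.filter (fun g : Sym2 (Fin n) => ∃ y ∈ Y, y ∈ g)).filter (fun g => ¬ g ∈ E), (1 - (w g : ℝ)) = 1 :=
      Finset.prod_eq_one fun g hg => by rw [hE0 g (Finset.mem_filter.1 hg).2, sub_zero]
    rw [h2, mul_one]
    exact h1
  have hpref0 : 0 ≤ p₀ ^ E.card := pow_nonneg hp0.le _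
  have hcov' : p₀ ^ (2 * E.card + 2) * (f (insert e η₁) - f (η₁ \ {e})) ≤
      (∫ ζ in U, f ζ ∂(prodBernoulli qY)) - (prodBernoulli qY).real U * ∫ ζ, f ζ ∂(prodBernoulli qY) := by
    have hle : p₀ ^ (2 * E.card + 2) ≤ p₀ ^ (2 * EY.card + 2) := pow_le_pow_of_le_one hp0.le hp01 (by omega)
    calc p₀ ^ (2 * E.card + 2) * (f (insert e η₁) - f (η₁ \ {e}))
        ≤ p₀ ^ (2 * EY.card + 2) * (f (insert e η₁) - f (η₁ \ {e})) := mul_le_mul_of_nonneg_right hle hJ0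
      _ ≤ _ := by linarith [hcov, mul_comm ((prodBernoulli qY).real U) (∫ ζ, f ζ ∂(prodBernoulli qY))]
  have hiso0 : 0 ≤ (∫ ζ in U, f ζ ∂(prodBernoulli qY)) - (prodBernoulli qY).real U * ∫ ζ, f ζ ∂(prodBernoulli qY) :=
    le_trans (mul_nonneg (pow_nonneg hp0.le _) hJ0) hcov'
  have h := mul_le_mul hpref hcov' (mul_nonneg (pow_nonneg hp0.le _) hJ0) (hpref0.trans hpref)
  have hpow : p₀ ^ E.card * (p₀ ^ (2 * E.card + 2) * (f (insert e η₁) - f (η₁ \ {e}))) =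
      p₀ ^ (3 * E.card + 2) * (f (insert e η₁) - f (η₁ \ {e})) := by ring
  rw [hpow] at h
  simp only [hY, hU, hqY, hfdef] at h
  exact h

/-- **Explicit (S5) margin from one isolated witness**: weights `w = 0` off `E`, `p₀ ≤ w ≤ 1 − p₀` on `E` (`0 < p₀`); `o ≠ v` off `T`; `F`
monotone nonnegative; `r` injective on `T` and compatible with the means; a relay `a ∈ T`, a pair `e ∈ E` missing `T_{<a}`, witnesses `η₁`
(`F`-jump `J`) and `η₂` (the floor's event at `a`) inside the pairs of `E` missing `T_{<a}`.  Then **`p₀^{3|E|+2} · J ≤ s5dMargin w T r [] o v F`**.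
[cite: KozmaNitzan2024, Conj. 4 (p. 32)] [cite: Harris1960, Lemma 4.1 (p. 16)] -/
theorem s5dMargin_nil_ge_explicit (w : Sym2 (Fin n) → unitInterval) (E : Finset (Sym2 (Fin n))) (p₀ : ℝ) (hp0 : 0 < p₀)
    (hE0 : ∀ f, f ∉ E → (w f : ℝ) = 0) (hE1 : ∀ f ∈ E, p₀ ≤ (w f : ℝ) ∧ (w f : ℝ) ≤ 1 - p₀)
    (T : Finset (Fin n)) (r : Fin n → ℕ) (hr : Set.InjOn r ↑T) (o v : Fin n) (hoT : o ∉ T) (hvT : v ∉ T) (hov : o ≠ v)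
    (F : Set (Fin n) → ℝ) (hF : ∀ S S' : Set (Fin n), S ⊆ S' → F S ≤ F S') (hF0 : ∀ S : Set (Fin n), 0 ≤ F S)
    (hcompat : ∀ a ∈ T, ∀ a' ∈ T, r a < r a' →
      ∫ ω, F (openCluster ω a) ∂(prodBernoulli w) ≤ ∫ ω, F (openCluster ω a') ∂(prodBernoulli w))
    (a : Fin n) (ha : a ∈ T)
    (e : Sym2 (Fin n)) (heE : e ∈ E) (heY : ∀ y ∈ (↑(T.filter (fun b => r b < r a)) : Set (Fin n)), y ∉ e)
    (η₁ : Set (Sym2 (Fin n))) (hη₁ : η₁ ⊆ {f | f ∈ (↑E : Set (Sym2 (Fin n))) ∧ ∀ y ∈ (↑(T.filter (fun b => r b < r a)) : Set (Fin n)), y ∉ f})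
    (η₂ : Set (Sym2 (Fin n))) (hη₂ : η₂ ⊆ {f | f ∈ (↑E : Set (Sym2 (Fin n))) ∧ ∀ y ∈ (↑(T.filter (fun b => r b < r a)) : Set (Fin n)), y ∉ f})
    (hU1 : insert e η₂ ∈ ((⋃ t ∈ (insert a (T.filter (fun b => r a < r b) ∪ ([] : List (Fin n)).toFinset)), openConn o t) ∪ openConn o v :
        Set (BondConfig (Fin n))))
    (hU0 : η₂ \ {e} ∉ ((⋃ t ∈ (insert a (T.filter (fun b => r a < r b) ∪ ([] : List (Fin n)).toFinset)), openConn o t) ∪ openConn o v :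
        Set (BondConfig (Fin n)))) :
    p₀ ^ (3 * E.card + 2) *
        (F {c | c = a ∨ ∃ e' ∈ openEdgeCluster (insert e η₁) a, c ∈ e'} - F {c | c = a ∨ ∃ e' ∈ openEdgeCluster (η₁ \ {e}) a, c ∈ e'}) ≤
      s5dMargin w T r [] o v F := by
  have hw1r : ∀ g, (w g : ℝ) < 1 := by
    intro g
    by_cases hg : g ∈ E
    · linarith [(hE1 g hg).2]
    · rw [hE0 g hg]; norm_num
  have hw : ∀ g, w g < 1 := fun g => by
    have h := hw1r g
    exact Subtype.coe_lt_coe.1 (by simpa using h)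
  have hiso := floor_iso_ge_explicit w E p₀ hp0 hE0 hE1 o v T r ([] : List (Fin n)) a F hF hF0 e heE heY η₁ hη₁ η₂ hη₂ hU1 hU0
  have hnn := fun a' (ha' : a' ∈ T) => isolatedFloor_term_nonneg w o v T r F hF hF0 hcompat a' ha'
  have hsum := Finset.single_le_sum (fun a' ha' => add_nonneg (hnn a' ha').1 (hnn a' ha').2) ha
  have hfloor := s5dMargin_ge_sum_rankGain_add_isolatedFloor_of_lt_one_of_compat w hw o v hov T r F hF hF0 hr hcompat hoT hvT
  linarith [(hnn a ha).1]

end CSH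

end Summit.CriticalPhenomena.PercolationContinuityZ3.Theorems

end
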